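/-
Copyright (c) 2026. All rights reserved.
Released under Apache 2.0 license as described in the file LICENSE.
-/
import Literature.NumberTheory.Weil1964.ArchWeilDatumFactorisationTransport
import Literature.AlgebraicGeometry.ShimuraVarieties.UnitaryBallCauchyRiemann
import HarnessLib

/-!
# Characters of `U(2,1)` are trivial along `exp 𝔭`; the archimedean factorisation along the `𝔭`-chart is character-free

Topic `RepresentationTheory/KonnoKonno2007`; namespace `Literature.RepresentationTheory.KonnoKonno2007` (dot-notation
extensions of `Literature.NumberTheory.Weil1964.IsBlockPair` are declared with their absolute names).  Origin:
`pub-hodgecm` MODEL-CONSTRUCTION sub-cell, theta lane (seat mc-theta-2 gen 14); companion of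
`Weil1964/ArchWeilDatumFactorisation` (the block factorisation `ω (s u) (Φ₁ ⊠ Φ₂) = χ(u) • (ω₁ u Φ₁) ⊠ Φ₂`,
`IsBlockPair.apply_tensorPi`) and of `KonnoKonno2007/JunctionCharacterSmooth` / `JunctionPMinusBallFrame` (the
analytic sockets along the exponential `𝔭`-chart `b ↦ exp X_b` of the ball, `BallForms.expP`).
KERNEL MATHEMATICS ONLY: theorems over the installed definitions (no new definition); no record, no cited
hypothesis, no named fact.

## The observation

Let `J = diag(1,1,-1) ∈ U(2,1)` (`BallModel.J`; it lies in the maximal compact `U(2) × U(1)`).  Conjugation by `J`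
is the Cartan involution: `J X_b J = X_{-b}` on `𝔭 = {X_b = [[0, b], [bᴴ, 0]]}` (`BallForms.pMat`), hence
`J · exp X_b · J = exp X_{-b} = (exp X_b)⁻¹`.  Consequently EVERY homomorphism `χ` from `U(2,1)` to a commutative
monoid satisfies `χ(exp X_b) = χ(J exp X_b J) = χ(exp X_b)⁻¹`, and since `exp X_b = (exp X_{b/2})²`,

  `χ (expP b) = χ (expP (b/2)) · χ (expP (b/2)) = χ (expP (b/2)) · χ (expP (b/2))⁻¹ = 1`

(`map_expP_eq_one`) — with no continuity, unitarity or Lie theory.  Applied to the factor character of a block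
pair (`IsBlockPair.factorCharHom`, any homomorphism `φ : U(2,1) →* G₁` into the small group) this gives the
**character-free exact factorisation along the `𝔭`-chart**

  `ω (s (φ (expP b))) (Φ₁ ⊠ Φ₂) = (ω₁ (φ (expP b)) Φ₁) ⊠ Φ₂`      (`IsBlockPair.apply_tensorPi_expP`)

from the `IsBlockPair` hypotheses ALONE (Heisenberg covariance and operator continuity of both families, block
identity) — neither orbit continuity (w1) nor unitary `L²` lifts (w2′) of the big family, nor continuity of `s`,
nor a circle-valued character are needed along the chart; and a twisted datum `charTwist χ ω₁` agrees with `ω₁` at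
every chart point (`charTwist_apply_hom_expP`).  The intertwined shapes `…_map` / `…_clm` match the `hA` / `L :=
τ ∘L (· ⊠ Φ₂)` sockets of `Weil1964/ArchWeilDatumFactorisationTransport` § 3 with the character deleted.

## Main statements

* `J_mem_U21`, `J_mul_pMat_mul_J`, `J_mul_exp_pMat_mul_J`, `mkU21_J_mul_expP_mul` — `J ∈ U(2,1)`,
  `J X_b J = X_{-b}` and `J · expP b · J = expP (-b)`;
* `expP_neg_mul_expP`, `expP_half_mul_expP_half` — `expP (-b) · expP b = 1`, `expP (b/2) · expP (b/2) = expP b`;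
* `map_expP_eq_one`, `map_hom_expP_eq_one` — `χ (expP b) = 1` for every homomorphism to a commutative monoid;
* `charTwist_apply_hom_expP` — `charTwist χ ω (φ (expP b)) = ω (φ (expP b))`;
* `IsBlockPair.factorChar_hom_expP`, `IsBlockPair.apply_tensorPi_expP`, `IsBlockPair.apply_tensorPi_expP_map`,
  `IsBlockPair.apply_sumProdLeft_expP_clm`, `IsBlockPair.apply_sumProdLeft_expP_clm_inl` — the factor character
  is `1` along the chart; the exact, character-free factorisation at product vectors, plain, through an
  intertwiner, and in the socket shape `G₁ = H₁ × H₂` of the model leaf.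

## References

* A. W. Knapp, *Lie Groups Beyond an Introduction*, 2nd ed., Progress in Math. 140, Birkhäuser (2002), Ch. VI §2
  (Cartan involution `θ`, `θ|_𝔭 = -1`). [Knapp2002]
* G. B. Folland, *Harmonic Analysis in Phase Space*, Annals of Math. Studies 122 (1989), Prop. (1.43), §4.2 (4.23).
  [Folland1989]
-/

noncomputable section

open scoped Matrix ComplexConjugate
open Literature.Geometry.ComplexHyperbolic.BallModel
open Literature.AlgebraicGeometry.ShimuraVarieties.BallForms
open Literature.Analysis.SegalBargmann Literature.Analysis.Distribution
open Literature.NumberTheory.Weil1964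

namespace Literature.RepresentationTheory.KonnoKonno2007

/-! ## § 1 The Cartan involution of `U(2,1)` inverts `exp 𝔭` -/

section Cartan

/-- **`J = diag(1,1,-1)` lies in `U(2,1)`**: `Jᴴ J J = J³ = J` (it is in the maximal compact `U(2) × U(1)`; the
element is `mkU21 J J_mem_U21`). [folklore] -/
theorem J_mem_U21 : Jᴴ * J * J = J := by rw [conjTranspose_J, J_mul_J, Matrix.one_mul]

/-- `J · J = 1` in `U(2,1)`. [folklore] -/
theorem mkU21_J_mul_self : mkU21 J J_mem_U21 * mkU21 J J_mem_U21 = 1 :=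
  mat_injective (by rw [mat_mul, mat_mkU21, J_mul_J, mat_one])

/-- `X_{-b} = -X_b`. [folklore] -/
theorem pMat_neg (b : Fin 2 → ℂ) : pMat (-b) = -pMat b := by
  have h := pMat_smul (-1) b
  simp only [neg_smul, one_smul] at h
  exact h

/-- **The Cartan involution is `-1` on `𝔭`**: `J X_b J = X_{-b}`. [cite: Knapp2002, Ch. VI §2] -/
theorem J_mul_pMat_mul_J (b : Fin 2 → ℂ) : J * pMat b * J = pMat (-b) := by
  ext i j
  simp only [J, Matrix.mul_diagonal, Matrix.diagonal_mul, pMat_neg, Matrix.neg_apply]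
  fin_cases i <;> fin_cases j <;> simp [pMat]

/-- **`J · exp X_b · J = exp X_{-b}`** (matrices). [cite: Knapp2002, Ch. VI §2] -/
theorem J_mul_exp_pMat_mul_J (b : Fin 2 → ℂ) :
    J * NormedSpace.exp (pMat b) * J = NormedSpace.exp (pMat (-b)) := by
  have hJu : IsUnit J := by
    rw [Matrix.isUnit_iff_isUnit_det, det_J]; norm_num
  have hJinv : J⁻¹ = J := Matrix.inv_eq_left_inv J_mul_J
  rw [← J_mul_pMat_mul_J, show J * pMat b * J = J * pMat b * J⁻¹ by rw [hJinv], Matrix.exp_conj _ _ hJu, hJinv]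

/-- **`J · exp X_b · J = exp X_{-b}` in `U(2,1)`.** [cite: Knapp2002, Ch. VI §2] -/
theorem mkU21_J_mul_expP_mul (b : Fin 2 → ℂ) :
    mkU21 J J_mem_U21 * expP b * mkU21 J J_mem_U21 = expP (-b) :=
  mat_injective (by rw [mat_mul, mat_mul, mat_mkU21, mat_expP, mat_expP, J_mul_exp_pMat_mul_J])

/-- `exp X_{-b} · exp X_b = 1`. [folklore] -/
theorem expP_neg_mul_expP (b : Fin 2 → ℂ) : expP (-b) * expP b = 1 := by
  have h := expP_add_smul (-1) 1 b
  simp only [neg_add_cancel, zero_smul, expP_zero, neg_smul, one_smul] at h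
  exact h.symm

/-- `exp X_{b/2} · exp X_{b/2} = exp X_b`. [folklore] -/
theorem expP_half_mul_expP_half (b : Fin 2 → ℂ) :
    expP ((1 / 2 : ℝ) • b) * expP ((1 / 2 : ℝ) • b) = expP b := by
  rw [← expP_add_smul, add_halves, one_smul]

/-- **Every homomorphism from `U(2,1)` to a commutative monoid is trivial on `exp 𝔭`:** `χ (exp X_b) = 1`.
(`χ (exp X_c)` is its own inverse because `exp X_{-c} = J (exp X_c) J` is conjugate to `exp X_c`, and `exp X_b` is
the square of `exp X_{b/2}`.)  No continuity is needed. [cite: Knapp2002, Ch. VI §2] -/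
theorem map_expP_eq_one {M : Type*} [CommMonoid M] (χ : U21 →* M) (b : Fin 2 → ℂ) : χ (expP b) = 1 := by
  have hconj : ∀ c : Fin 2 → ℂ, χ (expP (-c)) = χ (expP c) := fun c => by
    rw [← mkU21_J_mul_expP_mul, map_mul, map_mul, mul_comm (χ (mkU21 J J_mem_U21)) (χ (expP c)), mul_assoc,
      ← map_mul, mkU21_J_mul_self, map_one, mul_one]
  have hsq : ∀ c : Fin 2 → ℂ, χ (expP c) * χ (expP c) = 1 := fun c => by
    calc χ (expP c) * χ (expP c) = χ (expP (-c)) * χ (expP c) := by rw [hconj]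
      _ = χ (expP (-c) * expP c) := (map_mul χ _ _).symm
      _ = 1 := by rw [expP_neg_mul_expP, map_one]
  rw [← expP_half_mul_expP_half, map_mul]
  exact hsq _

/-- **… and so is every homomorphism out of a group receiving `U(2,1)`**: `χ (φ (exp X_b)) = 1`. [folklore] -/
theorem map_hom_expP_eq_one {G M : Type*} [Monoid G] [CommMonoid M] (φ : U21 →* G) (χ : G →* M)
    (b : Fin 2 → ℂ) : χ (φ (expP b)) = 1 :=
  map_expP_eq_one (χ.comp φ) b

end Cartan

/-! ## § 2 Character twists are invisible along the `𝔭`-chart -/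

section Twist

variable {G V : Type*} [Group G] [AddCommGroup V] [Module ℂ V]

/-- **`(χ ⊗ ω) (φ (exp X_b)) v = ω (φ (exp X_b)) v`** for every scalar character `χ : G →* ℂ`. [folklore] -/
theorem charTwist_apply_hom_expP (χ : G →* ℂ) (ω : Representation ℂ G V) (φ : U21 →* G) (b : Fin 2 → ℂ)
    (v : V) : charTwist χ ω (φ (expP b)) v = ω (φ (expP b)) v := by
  rw [charTwist_apply, map_hom_expP_eq_one φ χ b, one_smul]

/-- operator form: `(χ ⊗ ω) (φ (exp X_b)) = ω (φ (exp X_b))`. [folklore] -/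
theorem charTwist_hom_expP (χ : G →* ℂ) (ω : Representation ℂ G V) (φ : U21 →* G) (b : Fin 2 → ℂ) :
    charTwist χ ω (φ (expP b)) = ω (φ (expP b)) :=
  LinearMap.ext (charTwist_apply_hom_expP χ ω φ b)

end Twist

/-! ## § 3 The block factorisation along the `𝔭`-chart is character-free

Dot-notation extensions of `Literature.NumberTheory.Weil1964.IsBlockPair` (structure of another directory), declared
with their absolute names. -/

section BlockPair

open Literature.RepresentationTheory.HeisenbergGroup

variable {σ₁ σ₂ : Type*} [Fintype σ₁] [Fintype σ₂] [DecidableEq σ₁] [DecidableEq σ₂]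
variable {G₁ G : Type*} [Group G₁] [Group G]
variable {ι : G → PhaseMap (σ₁ ⊕ σ₂)} {ω : Representation ℂ G (SchwartzMap (σ₁ ⊕ σ₂ → ℝ) ℂ)}
  {ι₁ : G₁ → PhaseMap σ₁} {ω₁ : Representation ℂ G₁ (SchwartzMap (σ₁ → ℝ) ℂ)} {s : G₁ →* G}

/-- **the factor character is `1` along the chart**: `χ (φ (exp X_b)) = 1`. [folklore] -/
theorem _root_.Literature.NumberTheory.Weil1964.IsBlockPair.factorChar_hom_expP (h : IsBlockPair ι ω ι₁ ω₁ s)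
    (φ : U21 →* G₁) (b : Fin 2 → ℂ) : h.factorChar (φ (expP b)) = 1 := by
  rw [← IsBlockPair.factorCharHom_apply]
  exact map_hom_expP_eq_one φ h.factorCharHom b

/-- **CHARACTER-FREE EXACT FACTORISATION ALONG THE `𝔭`-CHART**:
`ω (s (φ (exp X_b))) (Φ₁ ⊠ Φ₂) = (ω₁ (φ (exp X_b)) Φ₁) ⊠ Φ₂` for a block pair and any `φ : U(2,1) →* G₁` — from
covariance, operator continuity and the block identity alone. [cite: Folland1989, Prop. (1.43)] -/
theorem _root_.Literature.NumberTheory.Weil1964.IsBlockPair.apply_tensorPi_expP (h : IsBlockPair ι ω ι₁ ω₁ s)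
    (φ : U21 →* G₁) (b : Fin 2 → ℂ) (Φ₁ : SchwartzMap (σ₁ → ℝ) ℂ) (Φ₂ : SchwartzMap (σ₂ → ℝ) ℂ) :
    ω (s (φ (expP b))) (tensorPi Φ₁ Φ₂) = tensorPi (ω₁ (φ (expP b)) Φ₁) Φ₂ := by
  rw [h.apply_tensorPi, h.factorChar_hom_expP φ b, one_smul]

/-- **through an intertwiner** (`hA` socket of `ArchWeilDatumFactorisationTransport` § 3, character deleted): if
`A p (τ x) = τ (ω (s (φ (exp X_{c p}))) x)` then `A p (τ (Φ₁ ⊠ Φ₂)) = τ ((ω₁ (φ (exp X_{c p})) Φ₁) ⊠ Φ₂)`.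
[cite: Folland1989, Prop. (1.43)] -/
theorem _root_.Literature.NumberTheory.Weil1964.IsBlockPair.apply_tensorPi_expP_map {F : Type*} [AddCommGroup F]
    [Module ℂ F] {P' : Type*} (h : IsBlockPair ι ω ι₁ ω₁ s) (φ : U21 →* G₁)
    (τ : SchwartzMap (σ₁ ⊕ σ₂ → ℝ) ℂ →ₗ[ℂ] F) (A : P' → F →ₗ[ℂ] F) (c : P' → (Fin 2 → ℂ))
    (hA : ∀ (p : P') (x : SchwartzMap (σ₁ ⊕ σ₂ → ℝ) ℂ), A p (τ x) = τ (ω (s (φ (expP (c p)))) x)) (p : P')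
    (Φ₁ : SchwartzMap (σ₁ → ℝ) ℂ) (Φ₂ : SchwartzMap (σ₂ → ℝ) ℂ) :
    A p (τ (tensorPi Φ₁ Φ₂)) = τ (tensorPi (ω₁ (φ (expP (c p))) Φ₁) Φ₂) := by
  rw [hA, h.apply_tensorPi_expP]

/-- **along `L := τ ∘L (· ⊠ Φ₂)`** (the `hω` socket shape of the junction transport lemmas, character deleted):
`A p (L Φ₁) = L (ω₁ (φ (exp X_{c p})) Φ₁)`. [cite: Folland1989, Prop. (1.43)] -/
theorem _root_.Literature.NumberTheory.Weil1964.IsBlockPair.apply_sumProdLeft_expP_clm {F : Type*}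
    [AddCommGroup F] [Module ℂ F] [TopologicalSpace F] {P' : Type*} (h : IsBlockPair ι ω ι₁ ω₁ s)
    (φ : U21 →* G₁) (τ : SchwartzMap (σ₁ ⊕ σ₂ → ℝ) ℂ →L[ℂ] F) (A : P' → F →ₗ[ℂ] F) (c : P' → (Fin 2 → ℂ))
    (hA : ∀ (p : P') (x : SchwartzMap (σ₁ ⊕ σ₂ → ℝ) ℂ), A p (τ x) = τ (ω (s (φ (expP (c p)))) x))
    (Φ₂ : SchwartzMap (σ₂ → ℝ) ℂ) (p : P') (Φ₁ : SchwartzMap (σ₁ → ℝ) ℂ) :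
    A p (τ.comp (SchwartzMap.sumProdLeftCLM Φ₂) Φ₁) =
      τ.comp (SchwartzMap.sumProdLeftCLM Φ₂) (ω₁ (φ (expP (c p))) Φ₁) := by
  simp only [ContinuousLinearMap.comp_apply, sumProdLeftCLM_apply_eq_tensorPi]
  exact h.apply_tensorPi_expP_map φ (τ : SchwartzMap (σ₁ ⊕ σ₂ → ℝ) ℂ →ₗ[ℂ] F) A c hA p Φ₁ Φ₂

/-- **socket shape of the model leaf** (`G₁ = H₁ × H₂`, chart through the first factor along any homomorphism
`eU : U(2,1) → H₁`, e.g. the frame `u21FrameEquiv`): if `A p (τ x) = τ (ω (s (eU (exp X_{c p}), 1)) x)` then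
`A p (L Φ₁) = L (ω₁ (eU (exp X_{c p}), 1) Φ₁)` with `L := τ ∘L (· ⊠ Φ₂)` — no character, no (w1)/(w2′) of `ω`.
[cite: Folland1989, Prop. (1.43)] -/
theorem _root_.Literature.NumberTheory.Weil1964.IsBlockPair.apply_sumProdLeft_expP_clm_inl {H₁ H₂ : Type*}
    [Group H₁] [Group H₂] {ι₁' : H₁ × H₂ → PhaseMap σ₁} {ω₁' : Representation ℂ (H₁ × H₂) (SchwartzMap (σ₁ → ℝ) ℂ)}
    {s' : H₁ × H₂ →* G} (h : IsBlockPair ι ω ι₁' ω₁' s') {E₁ : Type*} [FunLike E₁ U21 H₁]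
    [MonoidHomClass E₁ U21 H₁] (eU : E₁) {F : Type*} [AddCommGroup F] [Module ℂ F] [TopologicalSpace F]
    {P' : Type*} (τ : SchwartzMap (σ₁ ⊕ σ₂ → ℝ) ℂ →L[ℂ] F) (A : P' → F →ₗ[ℂ] F) (c : P' → (Fin 2 → ℂ))
    (hA : ∀ (p : P') (x : SchwartzMap (σ₁ ⊕ σ₂ → ℝ) ℂ), A p (τ x) = τ (ω (s' (eU (expP (c p)), 1)) x))
    (Φ₂ : SchwartzMap (σ₂ → ℝ) ℂ) (p : P') (Φ₁ : SchwartzMap (σ₁ → ℝ) ℂ) :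
    A p (τ.comp (SchwartzMap.sumProdLeftCLM Φ₂) Φ₁) =
      τ.comp (SchwartzMap.sumProdLeftCLM Φ₂) (ω₁' (eU (expP (c p)), 1) Φ₁) := by
  have hA' : ∀ (p : P') (x : SchwartzMap (σ₁ ⊕ σ₂ → ℝ) ℂ), A p (τ x) =
      τ (ω (s' (((MonoidHom.inl H₁ H₂).comp (eU : U21 →* H₁)) (expP (c p)))) x) := fun p x => by
    simpa only [MonoidHom.coe_comp, Function.comp_apply, MonoidHom.inl_apply, MonoidHom.coe_coe] using hA p x
  simpa only [MonoidHom.coe_comp, Function.comp_apply, MonoidHom.inl_apply, MonoidHom.coe_coe] using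
    h.apply_sumProdLeft_expP_clm _ τ A c hA' Φ₂ p Φ₁

end BlockPair

end Literature.RepresentationTheory.KonnoKonno2007

end
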